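import Summits.NavierStokesRegularity.NavierStokesRegularity.Theorems.LogModulusBudget
import HarnessLib

/-!
# ROUND-19 (nsreg-p2, gen 21) — `LogModulusBudget`, §2: the engine conjecture `LogModulusBudget`
# (R19-E) and the tower it carries

Second part of planner nsreg-p2's ROUND-19 companion `R19-LogModulusBudget.lean` (v3, sha16
76d26907de711d48; §1 and the full module docstring with sources are in
`…Theorems.LogModulusBudget`, §§3–5 in `…Theorems.LogModulusBudgetFBC`; split for the 400-line rule
by the landing seat nsreg-p4 g12, body verbatim).  Contents: the engine conjecture
`LogModulusBudget` (R19-E: Lei–Zhang–Seregin's energy method run quantitatively in the full CKN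
gauge; `|u| ≤ K(1+M)^K exp(K(1+G)²)` on `Q(z₀,1/64)` from the log²-modulus `|Γ| ln²(1/r) ≤ G`), its
`G = 0` corollary `swirlFreePolynomialBound_of_logModulusBudget` (PROVED: the `b > a` law contains
R18's swirl-free law `SwirlFreePolynomialBound`), the composition `explicitBound_of_logModulus`, and
the two tower arrows `singleExp_of_polyLogModulus` (R19-A + R19-E ⇒ single exponential) and
`doubleExp_of_expLogModulus` (print regime + R19-E ⇒ double exponential), both PROVED modulo the
named conjectures.  Memo: `run/shared/lean/pub/ns-regularity-ideate/ns-regularity-ideate-p2/ROUND-19.md`.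
WHAT THIS IS NOT: not NS regularity — typed LINE material for the DORMANT route `SwirlThreshold`
(crux stmt-NavierStokesRegularity-2002); `LogModulusBudget` is an OPEN `@[conjecture]`; no crux claim.
-/

noncomputable section

namespace Summit.NavierStokesRegularity.NavierStokesRegularity.Theorems.LogModulusBudget

open MeasureTheory Set Filter Topology Metric
open scoped ENNReal NNReal Topology
open Literature.Analysis Literature.Analysis.FluidPDE
open Summit.NavierStokesRegularity.NavierStokesRegularity.Theorems.SwirlFreeBudget

/-! ## 2. The engine conjecture `LogModulusBudget` and the tower it carries -/

/-- **R19-E `LogModulusBudget` (conjecture; the engine) — Lei–Zhang–Seregin's energy method run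
QUANTITATIVELY in the full CKN gauge.**  Universal `K > 0`: every axisymmetric suitable weak solution
in `Q₁` with `A, C, D ≤ M` at all points of `Q(1/2)` and scales `≤ 1/4`, whose swirl obeys the
log²-modulus `|Γ| ln²(1/r) ≤ G` a.e. on `Q(z₀, 1/4)` about an axis point `z₀ ∈ Q(1/8)`, satisfies
`|u| ≤ K (1+M)^K · exp(K·(1+G)²)` a.e. on `Q(z₀, 1/64)` (the exponent is `G²`: §3, `closureProduct_fbcScale`).
Informal proof scheme (memo §1c; every step has a source or a kernel lemma below):
(E1) the localised energy identity for `(J, Ω) = (ω_r/r, ω_θ/r)` (`ω_r = -∂_z u_θ`) with product cut-offs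
`ζ = φ(r)ψ(z)ξ(t)` (axis boundary terms `≤ 0`: LZ17 p. 8 / Seregin 2022 Step 3; the stretching term
through the curl identity `∫[∇×(u_θe_θ)]·(ζ²J ∇(u_r/r)) = ∫u_θe_θ·(∇(ζ²J) × ∇(u_r/r))`; the swirl
weights `|u_θ|/r`, `u_θ²` through (FBC-1)/(FBC-2) with constants `16G`, `16G²/ln²(2δ)` — tree
`integral_abs_angVelQuot_mul_norm_sq_le`, `integral_swirl_sq_mul_norm_sq_le`; `∇²(u_r/r)` through
the LOCAL Lemma 2.1 — tree `…Lemma21Local`, constant `1` plus a cut-off error); (E2) the choice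
`δ = fbcScale G κ` (§3) making the closure product `K₀δ_*C_*²` absolute, all `δ⁻ᵏ` factors being
`2ᵏexp(kG²/√κ)` (`inv_fbcScale`) — THE ONLY EXPONENTIAL; (E3) the start dissolver of §4: the
`p₀ = 1/2` space–time start `‖(J,Ω)‖_{L^{1/2}(Q(z₀,1/4))} ≤ c(1+M)^{1/2}` (enstrophy `≤ N(1+M)`,
CTZ22 Lemma 3.1, Hölder against `r^{-2/3} ∈ L¹_loc`), interpolation of every cut-off term between
`L^{1/2}` and the energy level `L^{10/3}` with homogeneity `< 1`, and `giaquinta_iteration`;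
(E4) the GRONWALL-FREE endgame (memo §1d; print's endgames are not available in the gauge frame:
LZ17 §3 closes by an `L⁴`-Gronwall for `u_θ` costing `exp(B^{1/2})`, Seregin 2022 Step 4 integrates
`∂_z(u_θ/r) = -J` from a REGULAR cap, OP23 §7 restarts on an `exp(-exp)`-short time interval): with
`B = poly(M)exp(O(G²))` the `(J,Ω)`-energy on `Q(z₀,1/16)`, (a) div–curl: `b = u_re_r + u_ze_z ∈ L^∞_tH¹_x`,
`N_b ≤ C(M+B)^{1/2}` (`curl b = rΩ e_θ`); (b) `b` is then SUBCRITICAL (`L^∞_tL⁶_x`), so below the scale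
`ρ_* = N_b⁻²` the drift of the `Γ`-equation is small in CTZ22's class (`A_b(R) ≤ R N_b²`) and CTZ22
Lemmas 2.2–2.4 give a Hölder modulus of `Γ` at axis points with UNIVERSAL exponent `α₀`; (c) hence
`C(z',ρ) = C_b + C_θ ≤ ρ^{3/2}N_b³ + C(1+M)^{1.3}G^{0.4}(ρ/ρ_*)^{0.4α₀}` (interpolating the modulus
against `u_θ ∈ L^{10/3}`), small for `ρ ≤ ρ_** = poly⁻¹`; (d) the pressure decay iteration
`D(γρ) ≤ c(γD(ρ) + γ⁻²C(ρ))` from `D ≤ M`, `O(log((1+M)/ε))` steps; (e) one-scale ε-regularity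
(CKN Prop. 1 / Lin 1998) `⇒ |u| ≤ C/ρ₂`, `ρ₂ = poly(M)⁻¹exp(-O(G²))`, uniformly on `Q(z₀,1/64)` by
covering (near-axis points through axis-centred cylinders, the rest off-axis with `|u_θ| ≤ 2|Γ|/r`).
At `G = 0` this is R18's P₀ (`swirlFreePolynomialBound_of_logModulusBudget`).
Why it might fail: (E3)(ii) — a cut-off term of the coupled system whose interpolation homogeneity
reaches `1` without carrying the small FBC-2 constant (test T-19.2 is the term-by-term table); or
(E4b) — the smallness class of CTZ22's oscillation lemma read for the drift `b` alone. -/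
@[conjecture] def LogModulusBudget : Prop :=
  ∃ K : ℝ, 0 < K ∧
    ∀ (u : ℝ → EuclideanSpace ℝ (Fin 3) → EuclideanSpace ℝ (Fin 3))
      (p : ℝ → EuclideanSpace ℝ (Fin 3) → ℝ),
      IsSuitableWeakSolutionInBall 1 0 u p →
      (∀ t ∈ Ioo (-1 : ℝ) 0, IsAxisymmetric (u t)) →
      (∀ t ∈ Ioo (-1 : ℝ) 0, IsAxisymmetricScalar (p t)) →
      ∀ M : ℝ, 0 ≤ M → FullGauge M u p →
      ∀ z₀ ∈ parabolicCylinder (1 / 8) (0 : ℝ × EuclideanSpace ℝ (Fin 3)), cylRadius z₀.2 = 0 →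
      ∀ G : ℝ, 0 ≤ G →
      (∀ᵐ z ∂(volume.restrict (parabolicCylinder (1 / 4) z₀)),
        |swirl (u z.1) z.2| * logSqWeight z.2 ≤ G) →
      ∀ᵐ z ∂(volume.restrict (parabolicCylinder (1 / 64) z₀)),
        ‖u z.1 z.2‖ ≤ K * (1 + M) ^ K * Real.exp (K * (1 + G) ^ 2)

/-- **The `b > a` law CONTAINS the `a = b` law (PROVED): `LogModulusBudget ⇒ SwirlFreePolynomialBound`.**
Swirl-free a.e. on `Q(z₀, 1/4)` is the case `G = 0` of the log²-modulus; the factor `e^K` is absorbed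
by `K' = K e^K`. -/
theorem swirlFreePolynomialBound_of_logModulusBudget (h : LogModulusBudget) :
    SwirlFreePolynomialBound := by
  obtain ⟨K, hK, hb⟩ := h
  have hK' : K ≤ K * Real.exp K := by
    have : 1 ≤ Real.exp K := Real.one_le_exp hK.le
    nlinarith
  refine ⟨K * Real.exp K, by positivity, ?_⟩
  intro u p hsol hax hpax M hM hFG z₀ hz₀ haxis hsw
  have hmod : ∀ᵐ z ∂(volume.restrict (parabolicCylinder (1 / 4) z₀)),
      |swirl (u z.1) z.2| * logSqWeight z.2 ≤ 0 := by
    filter_upwards [hsw] with z hz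
    rw [hz, abs_zero, zero_mul]
  have := hb u p hsol hax hpax M hM hFG z₀ hz₀ haxis 0 le_rfl hmod
  filter_upwards [this] with z hz
  have hM1 : 1 ≤ 1 + M := by linarith
  have hpow : (1 + M) ^ K ≤ (1 + M) ^ (K * Real.exp K) :=
    Real.rpow_le_rpow_of_exponent_le hM1 hK'
  calc ‖u z.1 z.2‖ ≤ K * (1 + M) ^ K * Real.exp (K * (1 + 0) ^ 2) := hz
    _ = K * Real.exp K * (1 + M) ^ K := by norm_num; ring
    _ ≤ K * Real.exp K * (1 + M) ^ (K * Real.exp K) := by gcongr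

/-- **Composition (PROVED): engine + modulus law ⇒ explicit local bound `K(1+M)^K exp(K(1+G(M))²)`.** -/
theorem explicitBound_of_logModulus {G : ℝ → ℝ} (hB : LogModulusBudget) (hG : SwirlLogModulus G)
    (hG0 : ∀ M, 0 ≤ M → 0 ≤ G M) :
    ∃ K : ℝ, 0 < K ∧
      ∀ (u : ℝ → EuclideanSpace ℝ (Fin 3) → EuclideanSpace ℝ (Fin 3))
        (p : ℝ → EuclideanSpace ℝ (Fin 3) → ℝ),
        IsSuitableWeakSolutionInBall 1 0 u p →
        (∀ t ∈ Ioo (-1 : ℝ) 0, IsAxisymmetric (u t)) →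
        (∀ t ∈ Ioo (-1 : ℝ) 0, IsAxisymmetricScalar (p t)) →
        ∀ M : ℝ, 0 ≤ M → FullGauge M u p →
        ∀ z₀ ∈ parabolicCylinder (1 / 8) (0 : ℝ × EuclideanSpace ℝ (Fin 3)), cylRadius z₀.2 = 0 →
        ∀ᵐ z ∂(volume.restrict (parabolicCylinder (1 / 64) z₀)),
          ‖u z.1 z.2‖ ≤ K * (1 + M) ^ K * Real.exp (K * (1 + G M) ^ 2) := by
  obtain ⟨K, hK, hb⟩ := hB
  exact ⟨K, hK, fun u p hsol hax hpax M hM hFG z₀ hz₀ haxis =>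
    hb u p hsol hax hpax M hM hFG z₀ hz₀ haxis (G M) (hG0 M hM)
      (hG u p hsol hax hpax M hM hFG z₀ hz₀ haxis)⟩

/-- Algebra of the tower: `K(1+M)^K · exp(K X) ≤ exp(2K(1+M) + K X)` (`K ≤ e^K`, `(1+M)^K ≤ e^{K(1+M)}`). -/
theorem poly_mul_exp_le {K M X : ℝ} (hK : 0 < K) (hM : 0 ≤ M) :
    K * (1 + M) ^ K * Real.exp (K * X) ≤ Real.exp (2 * K * (1 + M) + K * X) := by
  have hM0 : 0 < 1 + M := by linarith
  have h1 : K ≤ Real.exp K := by linarith [Real.add_one_le_exp K]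
  have h2 : (1 + M) ^ K ≤ Real.exp (K * (1 + M)) := by
    rw [Real.rpow_def_of_pos hM0]
    apply Real.exp_le_exp.2
    have hlog : Real.log (1 + M) ≤ 1 + M := (Real.log_le_sub_one_of_pos hM0).trans (by linarith)
    nlinarith
  have h3 : Real.exp K ≤ Real.exp (K * (1 + M)) := Real.exp_le_exp.2 (by nlinarith)
  calc K * (1 + M) ^ K * Real.exp (K * X)
      ≤ Real.exp (K * (1 + M)) * Real.exp (K * (1 + M)) * Real.exp (K * X) := by
        gcongr
        · exact h1.trans h3
    _ = Real.exp (2 * K * (1 + M) + K * X) := by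
        rw [← Real.exp_add, ← Real.exp_add]; congr 1; ring

/-- **Threshold crossed (PROVED modulo R19-A and R19-E): a polynomial log²-modulus constant gives a
SINGLE-exponential local bound** `|u| ≤ exp(K'(1+M)^{K'})` on `Q(z₀, 1/64)`. -/
theorem singleExp_of_polyLogModulus {q : ℝ} (hq : 0 ≤ q) (hP : PolyLogModulus q)
    (hB : LogModulusBudget) :
    ∃ K' : ℝ, 0 < K' ∧
      ∀ (u : ℝ → EuclideanSpace ℝ (Fin 3) → EuclideanSpace ℝ (Fin 3))
        (p : ℝ → EuclideanSpace ℝ (Fin 3) → ℝ),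
        IsSuitableWeakSolutionInBall 1 0 u p →
        (∀ t ∈ Ioo (-1 : ℝ) 0, IsAxisymmetric (u t)) →
        (∀ t ∈ Ioo (-1 : ℝ) 0, IsAxisymmetricScalar (p t)) →
        ∀ M : ℝ, 0 ≤ M → FullGauge M u p →
        ∀ z₀ ∈ parabolicCylinder (1 / 8) (0 : ℝ × EuclideanSpace ℝ (Fin 3)), cylRadius z₀.2 = 0 →
        ∀ᵐ z ∂(volume.restrict (parabolicCylinder (1 / 64) z₀)),
          ‖u z.1 z.2‖ ≤ Real.exp (K' * (1 + M) ^ K') := by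
  obtain ⟨c, hc, hG⟩ := hP
  obtain ⟨K, hK, hb⟩ :=
    explicitBound_of_logModulus hB hG (fun M hM => by positivity)
  -- `K' = max (2K + K(1+c)²) (max 1 (2q))`
  set q₁ : ℝ := max 1 (2 * q) with hq₁
  set K' : ℝ := max (2 * K + K * (1 + c) ^ 2) q₁ with hK'
  have hq₁1 : 1 ≤ q₁ := le_max_left _ _
  have hK'pos : 0 < K' := lt_of_lt_of_le (by positivity) (le_max_left _ _)
  refine ⟨K', hK'pos, ?_⟩
  intro u p hsol hax hpax M hM hFG z₀ hz₀ haxis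
  filter_upwards [hb u p hsol hax hpax M hM hFG z₀ hz₀ haxis] with z hz
  have hM1 : 1 ≤ 1 + M := by linarith
  have hM0 : 0 ≤ 1 + M := by linarith
  have hpoly := poly_mul_exp_le (X := (1 + c * (1 + M) ^ q) ^ 2) hK hM
  -- `(1 + c(1+M)^q)² ≤ (1+c)²(1+M)^{2q}` and `2K(1+M) + K(1+c)²(1+M)^{2q} ≤ K'(1+M)^{K'}`
  have hq1 : 1 ≤ (1 + M) ^ q := Real.one_le_rpow hM1 hq
  have hsq : (1 + c * (1 + M) ^ q) ^ 2 ≤ (1 + c) ^ 2 * (1 + M) ^ (2 * q) := by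
    have h1 : 1 + c * (1 + M) ^ q ≤ (1 + c) * (1 + M) ^ q := by nlinarith
    have h2 : (1 + M) ^ (2 * q) = ((1 + M) ^ q) ^ 2 := by
      rw [← Real.rpow_natCast ((1 + M) ^ q) 2, ← Real.rpow_mul hM0]; norm_num; ring_nf
    calc (1 + c * (1 + M) ^ q) ^ 2 ≤ ((1 + c) * (1 + M) ^ q) ^ 2 := by
          gcongr
      _ = (1 + c) ^ 2 * (1 + M) ^ (2 * q) := by rw [h2]; ring
  have e1 : (1 + M) ≤ (1 + M) ^ q₁ := by
    conv_lhs => rw [← Real.rpow_one (1 + M)]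
    exact Real.rpow_le_rpow_of_exponent_le hM1 hq₁1
  have e2 : (1 + M) ^ (2 * q) ≤ (1 + M) ^ q₁ :=
    Real.rpow_le_rpow_of_exponent_le hM1 (le_max_right _ _)
  have e3 : (1 + M) ^ q₁ ≤ (1 + M) ^ K' :=
    Real.rpow_le_rpow_of_exponent_le hM1 (le_max_right _ _)
  have hpow0 : 0 ≤ (1 + M) ^ K' := Real.rpow_nonneg (by linarith) _
  have hsum : 2 * K * (1 + M) + K * (1 + c * (1 + M) ^ q) ^ 2 ≤ K' * (1 + M) ^ K' := by
    have hA : 2 * K * (1 + M) ≤ 2 * K * (1 + M) ^ K' := by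
      have := e1.trans e3; nlinarith
    have hB' : K * (1 + c * (1 + M) ^ q) ^ 2 ≤ K * (1 + c) ^ 2 * (1 + M) ^ K' := by
      have := e2.trans e3
      have hc2 : 0 < K * (1 + c) ^ 2 := by positivity
      nlinarith [hsq]
    have hC : (2 * K + K * (1 + c) ^ 2) * (1 + M) ^ K' ≤ K' * (1 + M) ^ K' :=
      mul_le_mul_of_nonneg_right (le_max_left _ _) hpow0
    linarith
  exact hz.trans (hpoly.trans (Real.exp_le_exp.2 hsum))

/-- **The printed height (PROVED modulo R19-E): an exponential log²-modulus constant gives the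
DOUBLE-exponential local bound** `|u| ≤ exp(exp(K'(1+M)^{K'}))` — Ożański–Palasek's `exp exp 𝒩^{O(1)}`
in the local gauge frame, with no start exponential. -/
theorem doubleExp_of_expLogModulus {θ : ℝ} (_hθ : 0 ≤ θ) (hP : ExpLogModulus θ)
    (hB : LogModulusBudget) :
    ∃ K' : ℝ, 0 < K' ∧
      ∀ (u : ℝ → EuclideanSpace ℝ (Fin 3) → EuclideanSpace ℝ (Fin 3))
        (p : ℝ → EuclideanSpace ℝ (Fin 3) → ℝ),
        IsSuitableWeakSolutionInBall 1 0 u p →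
        (∀ t ∈ Ioo (-1 : ℝ) 0, IsAxisymmetric (u t)) →
        (∀ t ∈ Ioo (-1 : ℝ) 0, IsAxisymmetricScalar (p t)) →
        ∀ M : ℝ, 0 ≤ M → FullGauge M u p →
        ∀ z₀ ∈ parabolicCylinder (1 / 8) (0 : ℝ × EuclideanSpace ℝ (Fin 3)), cylRadius z₀.2 = 0 →
        ∀ᵐ z ∂(volume.restrict (parabolicCylinder (1 / 64) z₀)),
          ‖u z.1 z.2‖ ≤ Real.exp (Real.exp (K' * (1 + M) ^ K')) := by
  obtain ⟨C, hC, hG⟩ := hP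
  obtain ⟨K, hK, hb⟩ :=
    explicitBound_of_logModulus hB hG (fun M hM => (Real.exp_pos _).le)
  set q₁ : ℝ := max 1 θ with hq₁
  set K' : ℝ := max (6 * K + 2 * C + 1) q₁ with hK'
  have hq₁1 : 1 ≤ q₁ := le_max_left _ _
  have hK'pos : 0 < K' := lt_of_lt_of_le (by positivity) (le_max_left _ _)
  refine ⟨K', hK'pos, ?_⟩
  intro u p hsol hax hpax M hM hFG z₀ hz₀ haxis
  filter_upwards [hb u p hsol hax hpax M hM hFG z₀ hz₀ haxis] with z hz
  have hM1 : 1 ≤ 1 + M := by linarith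
  set E : ℝ := Real.exp (C * (1 + M) ^ θ) with hE
  have hpoly := poly_mul_exp_le (X := (1 + E) ^ 2) hK hM
  -- `(1+E)² ≤ 4E² = 4 exp(2C(1+M)^θ)`; `S = 2K(1+M) + 4K + 2C(1+M)^θ` dominates; `a + b ≤ 2e^S ≤ e^{S+1}`
  have hE1 : 1 ≤ E := Real.one_le_exp (by positivity)
  have hsq : (1 + E) ^ 2 ≤ 4 * Real.exp (2 * C * (1 + M) ^ θ) := by
    have h4 : (1 + E) ^ 2 ≤ 4 * E ^ 2 := by nlinarith
    have hE2 : E ^ 2 = Real.exp (2 * C * (1 + M) ^ θ) := by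
      rw [hE, sq, ← Real.exp_add]; congr 1; ring
    linarith [h4, hE2.le, hE2.ge]
  set S : ℝ := 2 * K * (1 + M) + 4 * K + 2 * C * (1 + M) ^ θ with hS
  have hpowθ : 0 ≤ (1 + M) ^ θ := Real.rpow_nonneg (by linarith) _
  have t1 : 2 * K * (1 + M) ≤ Real.exp S := by
    have : 2 * K * (1 + M) ≤ S := by
      have : 0 ≤ 2 * C * (1 + M) ^ θ := by positivity
      linarith
    exact this.trans ((by linarith [Real.add_one_le_exp S]) : S ≤ Real.exp S)
  have t2 : K * (1 + E) ^ 2 ≤ Real.exp S := by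
    have hKe : 4 * K ≤ Real.exp (4 * K) := by linarith [Real.add_one_le_exp (4 * K)]
    calc K * (1 + E) ^ 2 ≤ K * (4 * Real.exp (2 * C * (1 + M) ^ θ)) := by gcongr
      _ = 4 * K * Real.exp (2 * C * (1 + M) ^ θ) := by ring
      _ ≤ Real.exp (4 * K) * Real.exp (2 * C * (1 + M) ^ θ) := by gcongr
      _ = Real.exp (4 * K + 2 * C * (1 + M) ^ θ) := by rw [← Real.exp_add]
      _ ≤ Real.exp S := Real.exp_le_exp.2 (by nlinarith)
  have t3 : 2 * K * (1 + M) + K * (1 + E) ^ 2 ≤ Real.exp (S + 1) := by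
    have h2e : (2 : ℝ) ≤ Real.exp 1 := by
      have := Real.add_one_le_exp (1 : ℝ); linarith
    calc 2 * K * (1 + M) + K * (1 + E) ^ 2 ≤ 2 * Real.exp S := by linarith
      _ ≤ Real.exp 1 * Real.exp S := by gcongr
      _ = Real.exp (S + 1) := by rw [← Real.exp_add]; congr 1; ring
  -- `S + 1 ≤ K'(1+M)^{K'}`
  have e1 : (1 + M) ≤ (1 + M) ^ q₁ := by
    conv_lhs => rw [← Real.rpow_one (1 + M)]
    exact Real.rpow_le_rpow_of_exponent_le hM1 hq₁1
  have e2 : (1 + M) ^ θ ≤ (1 + M) ^ q₁ :=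
    Real.rpow_le_rpow_of_exponent_le hM1 (le_max_right _ _)
  have e3 : (1 + M) ^ q₁ ≤ (1 + M) ^ K' :=
    Real.rpow_le_rpow_of_exponent_le hM1 (le_max_right _ _)
  have hpow1 : 1 ≤ (1 + M) ^ K' := Real.one_le_rpow hM1 hK'pos.le
  have hS1 : S + 1 ≤ K' * (1 + M) ^ K' := by
    have hA : 2 * K * (1 + M) ≤ 2 * K * (1 + M) ^ K' := by
      have := e1.trans e3; nlinarith
    have hB' : 2 * C * (1 + M) ^ θ ≤ 2 * C * (1 + M) ^ K' := by
      have := e2.trans e3; nlinarith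
    have hC' : 4 * K + 1 ≤ (4 * K + 1) * (1 + M) ^ K' := by nlinarith
    have hD : (6 * K + 2 * C + 1) * (1 + M) ^ K' ≤ K' * (1 + M) ^ K' :=
      mul_le_mul_of_nonneg_right (le_max_left _ _) (by positivity)
    nlinarith
  exact hz.trans (hpoly.trans (Real.exp_le_exp.2 (t3.trans (Real.exp_le_exp.2 hS1))))

end Summit.NavierStokesRegularity.NavierStokesRegularity.Theorems.LogModulusBudget

end
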